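import Summits.AtomisticToContinuum.BoseEinsteinCondensation.Theorems.BECThomsonPrincipleFibreConductanceConditionalDefs
import HarnessLib

/-!
# Route `BECThomsonPrinciple`, crux `FibreConductance` (stmt-AtomisticToContinuum-9480),
# line `conditional-law-poincare` — stub `stub_momentOfCDM`, part B: the bath bookkeeping

Part B of the registered stub `stub_momentOfCDM : LocalChargeSqBound → ConditionalDensityMoments →
SobolevMomentBound` of the checked skeleton of the line `conditional-law-poincare` (the lead composes
part A `cubeMoment_le`, the pointwise cube bound, with this file's `sobolevMomentBound_of_cubeMoment`).

Given the CUBE MOMENT BOUND (hypothesis `hcm`, = the conclusion of part A): on every cube `Q` of side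
`ℓ = side L ν` of every fibre, `U_Q P_Q ≤ (5ℓ²/L³) ∫_Q (1 + g⁶ + g⁻⁶) dy` with `g = L³ψ²`, and gen 1's
`ConditionalDensityMoments` at order `p = 6` (`∫_{cellN} W (g⁶ + g⁻⁶) ≤ C₆ L³` for exact zero-free
minimisers at density `≤ ρ₀`), the SOBOLEV LEVEL of the crux's charge at the wavelength tiling
`ν = waveBlocks n` (`ν + 1 = ‖n‖_∞`, `ℓ = L/‖n‖_∞`) is

`sobolevLevel = L⁻³ ∫_{cellN} W Σ_Q U_Q P_Q ≤ L⁻³ · (5ℓ²/L³) · ∫_{cellN} W ∫_cell (1 + g⁶ + g⁻⁶) dy dX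
  = (5ℓ²/L³) ∫_{cellN} W (1 + g⁶ + g⁻⁶) ≤ (5ℓ²/L³)(L³ + C₆L³) = 5(1 + C₆) L²/‖n‖²`

(the cubes tile the cell, `lintegral_cell_eq_sum`; `W` is fibre-constant, `fibreW_update`; fibre
Fubini `lintegral_cellN_lintegral_update`; `∫_{cellN} W = L³`, `lintegral_cellN_fibreW`; the crux's norm
`‖(n_j)‖` on `Fin 3 → ℝ` is the sup norm `‖n‖_∞ = supIdx n`). Constants: `ρ₀, N₀` of
`ConditionalDensityMoments` at `p = 6`, `A = 5(1 + C₆)`; the window parameter is not used.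

All [folklore] (elementary measure theory and `ℝ≥0∞` bookkeeping over the landed vocabulary
`…ConditionalDefs` / `BECThomsonPrincipleFibreFubini` / `…StubTwoScaleSplitHelpers`).
-/

noncomputable section

namespace Summit.AtomisticToContinuum.BoseEinsteinCondensation.Cruxes.FibreConductance.ConditionalLawPoincare

open MeasureTheory Set
open scoped ENNReal
open Literature.MathematicalPhysics.QuantumManyBody.BoseGas
open Summit.AtomisticToContinuum.BoseEinsteinCondensation.Cruxes.FibreConductance.ParsevalShellBootstrap
open Summit.AtomisticToContinuum.BoseEinsteinCondensation.Cruxes.FibreConductance.HealingSplitKineticDefect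
open Summit.AtomisticToContinuum.BoseEinsteinCondensation.Cruxes.FibreConductance.TaggedPathHarnack
  (ConditionalDensityMoments)

variable {m : ℕ} {L : ℝ}

/-! ### The crux's norm is the sup norm; the wavelength side -/

/-- The crux's norm `‖(fun j => (n j : ℝ))‖` (Pi sup norm on `Fin 3 → ℝ`) is `‖n‖_∞ = supIdx n`.
[folklore] -/
theorem bm_norm_eq_supIdx (n : Fin 3 → ℤ) : ‖(fun j => (n j : ℝ))‖ = (supIdx n : ℝ) := by
  -- adapted from `Site.norm_eq_supNorm` (Literature/Probability/LatticeModels/SharpnessProofs.lean)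
  rw [Pi.norm_def]
  have h : (Finset.univ.sup fun b => ‖(n b : ℝ)‖₊) = ((supIdx n : ℕ) : NNReal) := by
    rw [supIdx, Nat.cast_finsetSup]
    congr 1
    funext b
    rw [NNReal.natCast_natAbs]
    apply NNReal.eq
    rw [coe_nnnorm, coe_nnnorm, Int.norm_cast_real]
  rw [h, NNReal.coe_natCast]

/-- The side of the wavelength cubes is `ℓ = L/‖n‖_∞ = L/‖(n_j)‖` (`n ≠ 0`). [folklore] -/
theorem bm_side_waveBlocks {n : Fin 3 → ℤ} (hn : n ≠ 0) (L : ℝ) :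
    side L (waveBlocks n) = L / ‖(fun j => (n j : ℝ))‖ := by
  rw [bm_norm_eq_supIdx, side, waveBlocks, Nat.cast_sub (one_le_supIdx hn), Nat.cast_one,
    sub_add_cancel]

/-! ### Bath bookkeeping -/

/-- **Cubes to fibre to bath.** If `F_Q(X̂) ≤ c ∫_Q G(y, X̂) dy` on every cube of every fibre for a
measurable `G ≥ 0`, then `∫_{cellN} (Σ_Q F_Q) W dX ≤ c · L³ · ∫_{cellN} G W dX` (the cubes tile the
cell, `W` is fibre-constant, fibre Fubini). [folklore] -/
theorem bm_lintegral_sum_mul_fibreW_le (hL : 0 < L) (ν : ℕ) (Φ : PeriodicTrialState (m + 1) L)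
    {F : (Fin 3 → Fin (ν + 1)) → Config (m + 1) → ℝ≥0∞} {G : Config (m + 1) → ℝ≥0∞}
    (hG : Measurable G) {c : ℝ≥0∞} (hc : c ≠ ⊤)
    (hF : ∀ Q X, F Q X ≤ c * ∫⁻ y in cubeSet L ν Q, G (Function.update X 0 y)) :
    ∫⁻ X in cellN (m + 1) L, (∑ Q, F Q X) * ENNReal.ofReal (fibreW Φ X) ≤
      c * (ENNReal.ofReal L ^ 3 * ∫⁻ X in cellN (m + 1) L, G X * ENNReal.ofReal (fibreW Φ X)) := by
  have hH : Measurable fun X => G X * ENNReal.ofReal (fibreW Φ X) :=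
    hG.mul (measurable_fibreW Φ).ennreal_ofReal
  rw [← lintegral_cellN_lintegral_update 0 hH, ← lintegral_const_mul' _ _ hc]
  refine lintegral_mono fun X => ?_
  have h1 : ∑ Q, F Q X ≤ c * ∫⁻ y in cell L, G (Function.update X 0 y) := by
    calc ∑ Q, F Q X ≤ ∑ Q, c * ∫⁻ y in cubeSet L ν Q, G (Function.update X 0 y) :=
          Finset.sum_le_sum fun Q _ => hF Q X
      _ = c * ∫⁻ y in cell L, G (Function.update X 0 y) := by
          rw [lintegral_cell_eq_sum hL ν, Finset.mul_sum]
  calc (∑ Q, F Q X) * ENNReal.ofReal (fibreW Φ X)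
      ≤ (c * ∫⁻ y in cell L, G (Function.update X 0 y)) * ENNReal.ofReal (fibreW Φ X) := by
        gcongr
    _ = c * ∫⁻ y in cell L, G (Function.update X 0 y) *
          ENNReal.ofReal (fibreW Φ (Function.update X 0 y)) := by
        rw [mul_assoc, ← lintegral_mul_const' _ _ ENNReal.ofReal_ne_top]
        simp only [fibreW_update]

/-- **The weighted moment.** `∫_{cellN} (1 + g⁶ + g⁻⁶) W ≤ (1 + C) L³` from `∫_{cellN} W = L³` and the
conditional density moment bound `∫_{cellN} W (g⁶ + g⁻⁶) ≤ C L³` (`g = L³ψ²`). [folklore] -/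
theorem bm_lintegral_weight_le (hL : 0 < L) (Φ : PeriodicTrialState (m + 1) L) {C : ℝ} (hC : 0 ≤ C)
    (h6 : ∫⁻ X in cellN (m + 1) L, ENNReal.ofReal (fibreW Φ X *
        ((L ^ 3 * fibrePsi Φ X ^ 2) ^ 6 + ((L ^ 3 * fibrePsi Φ X ^ 2)⁻¹) ^ 6)) ≤
      ENNReal.ofReal (C * L ^ 3)) :
    ∫⁻ X in cellN (m + 1) L, ENNReal.ofReal
        (1 + (L ^ 3 * fibrePsi Φ X ^ 2) ^ 6 + ((L ^ 3 * fibrePsi Φ X ^ 2)⁻¹) ^ 6) *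
          ENNReal.ofReal (fibreW Φ X) ≤ ENNReal.ofReal ((1 + C) * L ^ 3) := by
  have hsplit : ∀ X, ENNReal.ofReal
      (1 + (L ^ 3 * fibrePsi Φ X ^ 2) ^ 6 + ((L ^ 3 * fibrePsi Φ X ^ 2)⁻¹) ^ 6) *
        ENNReal.ofReal (fibreW Φ X) = ENNReal.ofReal (fibreW Φ X) + ENNReal.ofReal (fibreW Φ X *
          ((L ^ 3 * fibrePsi Φ X ^ 2) ^ 6 + ((L ^ 3 * fibrePsi Φ X ^ 2)⁻¹) ^ 6)) := by
    intro X
    have hW := fibreW_nonneg Φ X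
    have hg : 0 ≤ L ^ 3 * fibrePsi Φ X ^ 2 := by positivity
    have hS : 0 ≤ (L ^ 3 * fibrePsi Φ X ^ 2) ^ 6 + ((L ^ 3 * fibrePsi Φ X ^ 2)⁻¹) ^ 6 := by
      positivity
    rw [← ENNReal.ofReal_mul (by positivity), ← ENNReal.ofReal_add hW (mul_nonneg hW hS)]
    congr 1
    ring
  simp_rw [hsplit]
  rw [lintegral_add_left (measurable_fibreW Φ).ennreal_ofReal, lintegral_cellN_fibreW hL Φ]
  calc ENNReal.ofReal (L ^ 3) + ∫⁻ X in cellN (m + 1) L, ENNReal.ofReal (fibreW Φ X *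
          ((L ^ 3 * fibrePsi Φ X ^ 2) ^ 6 + ((L ^ 3 * fibrePsi Φ X ^ 2)⁻¹) ^ 6))
      ≤ ENNReal.ofReal (L ^ 3) + ENNReal.ofReal (C * L ^ 3) := add_le_add le_rfl h6
    _ = ENNReal.ofReal ((1 + C) * L ^ 3) := by
        rw [← ENNReal.ofReal_add (by positivity) (by positivity)]
        congr 1
        ring

/-- `ℝ≥0∞` bookkeeping of the constant: `(5ℓ²/L³) · ((1 + C) L³) = 5(1 + C)ℓ²` (`L > 0`). [folklore] -/
theorem bm_const_eq (hL : 0 < L) (ℓ C : ℝ) :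
    ENNReal.ofReal (5 * ℓ ^ 2 / L ^ 3) * ENNReal.ofReal ((1 + C) * L ^ 3) =
      ENNReal.ofReal (5 * (1 + C) * ℓ ^ 2) := by
  rw [← ENNReal.ofReal_mul (by positivity)]
  congr 1
  have hL3 : L ^ 3 ≠ 0 := by positivity
  field_simp

/-! ### The stub, part B -/

/-- **`stub_momentOfCDM`, part B (the bath bookkeeping).** From the cube moment bound
`U_Q P_Q ≤ (5ℓ²/L³)∫_Q (1 + g⁶ + g⁻⁶) dy` (part A, hypothesis `hcm`) and gen 1's
`ConditionalDensityMoments` at `p = 6`, the Sobolev level of the crux's charge at the wavelength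
tiling is `≤ 5(1 + C₆) L²/‖n‖²` in the crux's window: `SobolevMomentBound` with `ρ₀, N₀` of the
moment bound and `A = 5(1 + C₆)`. [folklore] -/
theorem sobolevMomentBound_of_cubeMoment
    (hcm : ∀ (m : ℕ) (L : ℝ), 0 < L → ∀ (ν : ℕ) (n : Fin 3 → ℤ) (Φ : PeriodicTrialState (m + 1) L),
      (∀ X, Φ.ψ X ≠ 0) → ∀ (Q : Fin 3 → Fin (ν + 1)) (X : Config (m + 1)),
        localSqOf L ν Φ (cruxCharge n Φ) Q X * holeFactor L ν Φ Q X ≤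
          ENNReal.ofReal (5 * side L ν ^ 2 / L ^ 3) *
            ∫⁻ y in cubeSet L ν Q, ENNReal.ofReal (1 + (L ^ 3 * fibrePsi Φ (Function.update X 0 y) ^ 2) ^ 6 +
              ((L ^ 3 * fibrePsi Φ (Function.update X 0 y) ^ 2)⁻¹) ^ 6))
    (hcdm : ConditionalDensityMoments) : SobolevMomentBound := by
  intro v hv hB M _hM
  obtain ⟨ρ₀, C, hρ₀, hC, N₀, h6⟩ := hcdm v hv hB 6
  refine ⟨ρ₀, 5 * (1 + C), hρ₀, by positivity, N₀, ?_⟩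
  intro m hm L hL hρ n hn _hw Φ hE hΦ
  have hI := h6 m hm L hL hρ Φ hE hΦ
  have hg : Measurable fun X => L ^ 3 * fibrePsi Φ X ^ 2 :=
    measurable_const.mul ((measurable_fibrePsi hL Φ hΦ).pow_const 2)
  have hG : Measurable fun X => ENNReal.ofReal
      (1 + (L ^ 3 * fibrePsi Φ X ^ 2) ^ 6 + ((L ^ 3 * fibrePsi Φ X ^ 2)⁻¹) ^ 6) :=
    ((measurable_const.add (hg.pow_const 6)).add (hg.inv.pow_const 6)).ennreal_ofReal
  have h0 : ENNReal.ofReal L ^ 3 ≠ 0 := pow_ne_zero _ (ENNReal.ofReal_pos.2 hL).ne'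
  have htop : ENNReal.ofReal L ^ 3 ≠ ⊤ := ENNReal.pow_ne_top ENNReal.ofReal_ne_top
  unfold sobolevLevelOf
  calc (ENNReal.ofReal L ^ 3)⁻¹ * ∫⁻ X in cellN (m + 1) L,
        (∑ Q, localSqOf L (waveBlocks n) Φ (cruxCharge n Φ) Q X * holeFactor L (waveBlocks n) Φ Q X) *
          ENNReal.ofReal (fibreW Φ X)
      ≤ (ENNReal.ofReal L ^ 3)⁻¹ * (ENNReal.ofReal (5 * side L (waveBlocks n) ^ 2 / L ^ 3) *
          (ENNReal.ofReal L ^ 3 * ∫⁻ X in cellN (m + 1) L, ENNReal.ofReal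
            (1 + (L ^ 3 * fibrePsi Φ X ^ 2) ^ 6 + ((L ^ 3 * fibrePsi Φ X ^ 2)⁻¹) ^ 6) *
              ENNReal.ofReal (fibreW Φ X))) := by
        gcongr
        exact bm_lintegral_sum_mul_fibreW_le hL (waveBlocks n) Φ hG ENNReal.ofReal_ne_top
          fun Q X => hcm m L hL (waveBlocks n) n Φ hΦ Q X
    _ = ENNReal.ofReal (5 * side L (waveBlocks n) ^ 2 / L ^ 3) *
          ∫⁻ X in cellN (m + 1) L, ENNReal.ofReal
            (1 + (L ^ 3 * fibrePsi Φ X ^ 2) ^ 6 + ((L ^ 3 * fibrePsi Φ X ^ 2)⁻¹) ^ 6) *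
              ENNReal.ofReal (fibreW Φ X) := by
        rw [mul_left_comm (ENNReal.ofReal (5 * side L (waveBlocks n) ^ 2 / L ^ 3)), ← mul_assoc,
          ENNReal.inv_mul_cancel h0 htop, one_mul]
    _ ≤ ENNReal.ofReal (5 * side L (waveBlocks n) ^ 2 / L ^ 3) * ENNReal.ofReal ((1 + C) * L ^ 3) := by
        gcongr
        exact bm_lintegral_weight_le hL Φ hC.le hI
    _ = ENNReal.ofReal (5 * (1 + C) * side L (waveBlocks n) ^ 2) := bm_const_eq hL _ _
    _ = ENNReal.ofReal (5 * (1 + C) * L ^ 2 / ‖(fun j => (n j : ℝ))‖ ^ 2) := by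
        rw [bm_side_waveBlocks hn, div_pow, mul_div_assoc]

end Summit.AtomisticToContinuum.BoseEinsteinCondensation.Cruxes.FibreConductance.ConditionalLawPoincare

end
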